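import Literature.NumberTheory.Automorphic.OrbitalMeasureCanonical
import Literature.NumberTheory.Automorphic.LocalUnitaryIntegralLevel
import Literature.NumberTheory.Rogawski1990.LocalTransfer
import Literature.MeasureTheory.Group.InvariantQuotientCompactOpenMass
import HarnessLib

/-!
# The compact core of a centraliser torus lies in the hyperspecial level at almost every place —
# the named fact `CompactCoreCentralizerLevelAE`, and the mass-one discharge for canonical orbital
# measure families
(Rogawski (1990), §4.3 p. 43 (measures on `G_γ` normalised so that the unramified computation gives
`vol T(𝒪_v) = 1`); Tits, *Reductive groups over local fields*, Corvallis (1979), §3.9 (integral models,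
hyperspecial subgroups); Platonov–Rapinchuk (1994), §6 (integral points of tori))

Topic `NumberTheory/Automorphic`; namespace `Literature.NumberTheory.Automorphic`. ONE NAMED FACT
(`def … : Prop`, a hypothesis for consumers, never inhabited here) and proved generic lemmas; no
`sorry`, no instance, no notation. Registry pub/hodgecm-mathlib F0∕P3a, ENGINE T1 line, F0P3a-plan (g3)
RULING #40 (2) ∕ #44 (ii) «F4-a», pin (viii′-3) «local orbital measures normalisable off `S₀(γ)`» of
ED. 1.19.

* §1 (generic, any topological group `Z`; then the setting of ★ `quotientMeasure`):
  `compactCore_eq_of_subset` — if the compact core of `Z` lies in a compact subgroup `K₀` then it IS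
  `K₀`; `measure_preimage_eq_one_of_compactCore_subset` — so a Haar measure `t` on a closed subgroup
  `Z ≤ G` with `t(compactCore Z) = 1` gives `Z ∩ K` mass `1` for every compact subgroup `K ≤ G` with
  `compactCore Z ⊆ Z ∩ K`; `quotientMeasure_image_mk_eq_one_of_compactCore_subset` — with ★ (F4-b)
  `quotientMeasure_image_mk_eq_one`: if moreover `K` is open and `ν(K) = 1`, the quotient measure
  `ν/t` gives `π(K) ⊆ G ⧸ Z` mass `1`; `IsCanonical.apply_image_mk_eq_one` — hence a CANONICAL orbital
  measure family (★ `OrbitalMeasureFamily.IsCanonical P ν`) gives the `K`-orbit of the base point of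
  `G ⧸ G_{γ_c}` mass `1` at every `P`-class `c` whose representative `γ_c = out c` has
  `compactCore G_{γ_c} ⊆ K`.
* §2 **NAMED FACT `UnitaryGroup.CompactCoreCentralizerLevelAE L N H`**: for every REGULAR rational
  `γ ∈ U(H)(L⁺)`, at all but finitely many finite places `v` of `L⁺` the compact core of the
  centraliser `Z(γ_v) ≤ U(H)(L⁺_v)` (the maximal compact subgroup of the torus `T_γ(L⁺_v)`) lies in the
  integral level `K_v = cmLocalIntegralLevel L N H v` — print-true and measure-free: `T_γ` extends to a
  torus over `𝒪_{L⁺,S}`, and at the places of good (unramified) reduction `T_γ(𝒪_v) = T_γ(L⁺_v) ∩ K_v`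
  is the unique maximal compact subgroup [Tits1979, §3.9; PlatonovRapinchuk1994, §6; Rogawski1990,
  §4.3 p. 43: the normalisation `vol(T(𝒪_v)) = 1` at the unramified places]. A hypothesis for
  consumers; not inhabited here.

What is NOT done here (one line each): the point-level form «`(mG v).atPoint γ_v (π K_v) = 1` for
almost all `v`» of the discharge, which reads ★-to-be `OrbitalMeasureFamily.atPoint` (F0P3a-p06 Q4-C2,
`UnitaryGroupOrbitalMeasureFamilyOfLocal`) and transports §1 along the conjugator `out ⟦γ_v⟧ ↦ γ_v`
(`image_compactCore`, conjugation invariance of `ν_v`); the proof of the named fact (integral models of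
tori).

## References

* J. D. Rogawski, *Automorphic Representations of Unitary Groups in Three Variables*, Annals of
  Mathematics Studies 123 (1990), §4.3 p. 43 [Rogawski1990].
* J. Tits, *Reductive groups over local fields*, Proc. Sympos. Pure Math. 33.1 (1979), §3.9
  [Tits1979].
* V. Platonov, A. Rapinchuk, *Algebraic Groups and Number Theory* (1994), §6 [PlatonovRapinchuk1994].
* A. Deitmar, S. Echterhoff, *Principles of Harmonic Analysis*, 2nd ed. (2014), Thm. 1.5.3
  [DeitmarEchterhoff2014].
-/

noncomputable section

open MeasureTheory Measure Set NumberField IsDedekindDomain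
open Literature.MeasureTheory.Group
open scoped ENNReal NNReal

namespace Literature.NumberTheory.Automorphic

/-! ## §1 Mass one on the level from mass one on the compact core -/

section Generic

variable {Z : Type*} [Group Z] [TopologicalSpace Z]

/-- **If the compact core lies in a compact subgroup `K₀`, it IS `K₀`** (a compact subgroup lies in
the compact core, ★ `subset_compactCore_of_isCompact`). [cite: BourbakiGT1, Ch. III §2] -/
theorem compactCore_eq_of_subset (K₀ : Subgroup Z) (hK₀ : IsCompact (K₀ : Set Z))
    (h : compactCore Z ⊆ K₀) : compactCore Z = K₀ :=
  Subset.antisymm h (subset_compactCore_of_isCompact hK₀)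

end Generic

section Quotient

variable {G : Type*} [Group G] [TopologicalSpace G] [IsTopologicalGroup G] [LocallyCompactSpace G]
  [SecondCountableTopology G] [T2Space G] [MeasurableSpace G] [BorelSpace G]
  (Z : Subgroup G) [hZ : IsClosed (Z : Set G)]

omit [IsTopologicalGroup G] [LocallyCompactSpace G] [SecondCountableTopology G] [T2Space G]
  [MeasurableSpace G] [BorelSpace G] in
/-- For a closed subgroup `Z ≤ G` and a compact subgroup `K ≤ G`: if `compactCore Z ⊆ Z ∩ K` then
`compactCore Z = Z ∩ K` (`Z ∩ K` is a compact subgroup of `Z`). [cite: BourbakiGT1, Ch. III §2] -/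
theorem compactCore_eq_preimage_of_subset (K : Subgroup G) (hKc : IsCompact (K : Set G))
    (h : compactCore Z ⊆ Subtype.val ⁻¹' (K : Set G)) :
    compactCore Z = (Subtype.val ⁻¹' (K : Set G) : Set Z) :=
  compactCore_eq_of_subset (K.subgroupOf Z) (hZ.isClosedEmbedding_subtypeVal.isCompact_preimage hKc) h

omit [IsTopologicalGroup G] [LocallyCompactSpace G] [SecondCountableTopology G] [T2Space G] [BorelSpace G] in
/-- **Mass one on the level from mass one on the compact core**: if a measure `t` on the closed
subgroup `Z` gives the compact core mass `1` and `compactCore Z ⊆ Z ∩ K` for a compact subgroup `K`,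
then `t(Z ∩ K) = 1`. [cite: Rogawski1990, §4.3 (p. 43)] -/
theorem measure_preimage_eq_one_of_compactCore_subset (t : Measure Z) (h1 : t (compactCore Z) = 1)
    (K : Subgroup G) (hKc : IsCompact (K : Set G)) (h : compactCore Z ⊆ Subtype.val ⁻¹' (K : Set G)) :
    t (Subtype.val ⁻¹' (K : Set G)) = 1 := by
  rwa [compactCore_eq_preimage_of_subset Z K hKc h] at h1

variable (t : Measure Z) [t.IsMulLeftInvariant] [IsFiniteMeasureOnCompacts t] [t.IsOpenPosMeasure]
  [t.IsInvInvariant] [SFinite t] (ν : Measure G) [IsHaarMeasure ν] [ν.IsMulRightInvariant]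
  [MeasurableSpace (G ⧸ Z)] [BorelSpace (G ⧸ Z)]

/-- **The quotient measure gives `π(K)` mass one**: for a compact open subgroup `K ≤ G` with
`ν(K) = 1` and a normalising measure `t` on `Z` (`t(compactCore Z) = 1`) whose compact core lies in
`K`, `(ν/t)(π(K)) = 1` (★ F4-b `quotientMeasure_image_mk_eq_one`). [cite: Rogawski1990, §4.3 (p. 43)]
[cite: DeitmarEchterhoff2014, Thm. 1.5.3] -/
theorem quotientMeasure_image_mk_eq_one_of_compactCore_subset (K : Subgroup G) (hK : IsOpen (K : Set G))
    (hKc : IsCompact (K : Set G)) (hν : ν K = 1) (h1 : t (compactCore Z) = 1)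
    (h : compactCore Z ⊆ Subtype.val ⁻¹' (K : Set G)) :
    quotientMeasure Z t hZ ν ((QuotientGroup.mk : G → G ⧸ Z) '' (K : Set G)) = 1 :=
  quotientMeasure_image_mk_eq_one Z t ν K hK hν
    (measure_preimage_eq_one_of_compactCore_subset Z t h1 K hKc h)

end Quotient

section Canonical

variable {G : Type*} [Group G] [TopologicalSpace G] [IsTopologicalGroup G] [LocallyCompactSpace G]
  [SecondCountableTopology G] [T2Space G] [MeasurableSpace G] [BorelSpace G]
  [∀ γ : G, MeasurableSpace (G ⧸ Subgroup.centralizer ({γ} : Set G))]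
  [∀ γ : G, BorelSpace (G ⧸ Subgroup.centralizer ({γ} : Set G))]

/-- **The (viii′-3) discharge at a class representative**: a CANONICAL orbital measure family for
`(P, ν)` (★ `OrbitalMeasureFamily.IsCanonical`: at each `P`-class `c`, `m c = ν/t` with `t` THE Haar
measure on `G_{γ_c}`, `γ_c = out c`, of mass one on the compact core) gives the `K`-orbit of the base
point mass ONE, `m c (π(K)) = 1`, at every `P`-class whose representative has `compactCore G_{γ_c} ⊆ K`,
for every compact open subgroup `K` with `ν(K) = 1` — Rogawski's normalisation of the unramified local
orbital integrals (`∫ 1_{K_v} = 1`). [cite: Rogawski1990, §4.3 (p. 43)] [cite: DeitmarEchterhoff2014, Thm. 1.5.3] -/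
theorem OrbitalMeasureFamily.IsCanonical.apply_image_mk_eq_one {P : G → Prop} {ν : Measure G}
    [ν.IsHaarMeasure] [ν.IsMulRightInvariant] {m : OrbitalMeasureFamily G} (hm : m.IsCanonical P ν)
    {c : ConjClasses G} (hc : P (Quotient.out c)) (K : Subgroup G) (hK : IsOpen (K : Set G))
    (hKc : IsCompact (K : Set G)) (hν : ν K = 1)
    (h : compactCore (Subgroup.centralizer ({(Quotient.out c : G)} : Set G)) ⊆ Subtype.val ⁻¹' (K : Set G)) :
    m c ((QuotientGroup.mk : G → G ⧸ Subgroup.centralizer ({(Quotient.out c : G)} : Set G)) '' (K : Set G)) = 1 := by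
  obtain ⟨t, ht, hti, h1, hmc⟩ := hm c hc
  haveI : IsClosed ((Subgroup.centralizer ({(Quotient.out c : G)} : Set G) : Subgroup G) : Set G) :=
    isClosed_coe_centralizer_singleton (Quotient.out c)
  haveI : LocallyCompactSpace (Subgroup.centralizer ({(Quotient.out c : G)} : Set G)) :=
    (isClosed_coe_centralizer_singleton (Quotient.out c)).isClosedEmbedding_subtypeVal.locallyCompactSpace
  haveI : SecondCountableTopology (Subgroup.centralizer ({(Quotient.out c : G)} : Set G)) :=
    TopologicalSpace.Subtype.secondCountableTopology _
  rw [hmc]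
  exact quotientMeasure_image_mk_eq_one_of_compactCore_subset _ t ν K hK hKc hν h1 h

end Canonical

/-! ## §2 The named fact for unitary groups -/

namespace UnitaryGroup

variable (L : Type) [Field L] [NumberField L] [IsCMField L] (N : ℕ) (H : Matrix (Fin N) (Fin N) L)

/-- **NAMED FACT — the compact core of a regular centraliser lies in the level at almost every
place.** For every rational `γ ∈ U(H)(L⁺)` which is regular semisimple (★ `IsRegularElt`: separable
characteristic polynomial), for all but finitely many finite places `v` of `L⁺` the compact core
(★ `compactCore`: the union of the compact subgroups — here the maximal compact subgroup of the torus
`T_γ(L⁺_v) = Z(γ_v)`) of the centraliser of `γ_v = toLocal v (toAdelic γ)` in `U(H)(L⁺_v)` is contained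
in the integral level `K_v = cmLocalIntegralLevel L N H v`. Print: the torus `T_γ` has an integral
model over `𝒪_{L⁺,S}` and for `v ∉ S` of good reduction `T_γ(𝒪_v) = T_γ(L⁺_v) ∩ K_v` is its unique
maximal compact subgroup (Tits (1979), §3.9; Platonov–Rapinchuk (1994), §6), which is the content of
Rogawski's normalisation `vol T(𝒪_v) = 1` of the measures on `G_γ` at the unramified places
(§4.3 p. 43). Measure-free; a hypothesis for consumers (ED. 1.19 pin (viii′-3) via
`IsCanonical.apply_image_mk_eq_one`); not inhabited here. [cite: Rogawski1990, §4.3 (p. 43)]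
[cite: Tits1979, §3.9] [cite: PlatonovRapinchuk1994, §6] -/
def CompactCoreCentralizerLevelAE : Prop :=
  ∀ γ : (cmDatum L N H).Rational, Rogawski1990.IsRegularElt (γ.val : GL (Fin N) L) →
    ∀ᶠ v : HeightOneSpectrum (𝓞 ↥(maximalRealSubfield L)) in Filter.cofinite,
      compactCore (Subgroup.centralizer
          ({(cmDatum L N H).toLocal v ((cmDatum L N H).toAdelic γ)} : Set ((cmDatum L N H).Local v))) ⊆
        Subtype.val ⁻¹' (cmLocalIntegralLevel L N H v : Set ((cmDatum L N H).Local v))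

/-- Unfolding of `CompactCoreCentralizerLevelAE`. [cite: Rogawski1990, §4.3 (p. 43)] -/
theorem compactCoreCentralizerLevelAE_iff :
    CompactCoreCentralizerLevelAE L N H ↔
      ∀ γ : (cmDatum L N H).Rational, Rogawski1990.IsRegularElt (γ.val : GL (Fin N) L) →
        ∀ᶠ v : HeightOneSpectrum (𝓞 ↥(maximalRealSubfield L)) in Filter.cofinite,
          compactCore (Subgroup.centralizer
              ({(cmDatum L N H).toLocal v ((cmDatum L N H).toAdelic γ)} : Set ((cmDatum L N H).Local v))) ⊆
            Subtype.val ⁻¹' (cmLocalIntegralLevel L N H v : Set ((cmDatum L N H).Local v)) :=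
  Iff.rfl

end UnitaryGroup

end Literature.NumberTheory.Automorphic
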